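import Summits.ABC.ABC.Theses.DefiniteXi
import Summits.ABC.ABC.Theorems.DefiniteXiFreyModularity
import Summits.ABC.ABC.Theorems.DefiniteXiFreyModularityCDT
import Literature.NumberTheory.EllipticCurves.ModularParametrizationDegreeHoldsProofs
import Literature.NumberTheory.Automorphic.BCDTModularity
import Literature.NumberTheory.EllipticCurves.Szpiro
import HarnessLib

/-!
# Route DefiniteXi, item `FreyModularity` (stmt-ABC-11340): the item is exactly "Frey curves are modular"

`FreyModularity` — every Frey curve `E_(a,b) = freyCurve a b` (`a, b` coprime, `ab(a+b) ≠ 0`)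
carries a `ModularParametrizationData` at its conductor level — was reduced by the earlier files of
this item to two named facts of the tree: Modularity in the form (2) of Breuil–Conrad–Diamond–Taylor
2001, p. 845 (`exists_isNewformOf`, for Frey curves already `BCDT.CDT_theorem_7_1_2`,
Conrad–Diamond–Taylor 1999 Thm. 7.1.2, since `27 ∤ N_{E_(a,b)}`), and the commensurability of the
Eichler–Shimura lattice `Λ_f` with the Néron-type lattice `Λ_E`
(`IsNewformOf.exists_maninConstant_ne_zero`, "(2) ⇒ (6)": Shimura's construction and Faltings'
isogeny theorem).  The second fact is now a THEOREM of the tree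
(`IsNewformOf.exists_maninConstant_ne_zero_holds`, `ModularParametrizationDegreeHoldsProofs.lean`:
Shimura's construction with the Eichler–Shimura congruence by Honda's method, and Faltings' isogeny
theorem `WeierstrassCurve.isIsogenous_iff_frobeniusTrace_eq_holds`).  This file cashes that in:

* `nonempty_modularParametrizationData_iff_isModularAt` — for every elliptic `W/ℚ` and level `N`:
  `Nonempty (ModularParametrizationData W N) ↔ ∃ f ∈ S₂(Γ₀(N)), IsNewformOf W f` (unconditional).
* `freyModularity_iff_forall_exists_isNewformOf_freyCurve` — **the exact residual, unconditionally**: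
  `FreyModularity ↔` every Frey curve has a newform `f ∈ S₂(Γ₀(N_E))` with `aₙ(f) = aₙ(E_(a,b))`,
  i.e. Modularity (2) restricted to the curves `y² = x(x − a)(x + b)`; nothing else is left.
* `freyModularity_iff_forall_isModular_freyCurve` — the same in the vocabulary of
  `BCDT.IsModular` (the conclusion of `BCDT.CDT_theorem_7_1_2` / of Theorem A).
* `freyModularity_of_CDT_theorem_7_1_2'` — `BCDT.CDT_theorem_7_1_2 → FreyModularity` (one
  hypothesis: CDT 1999 Thm. 7.1.2, "conductor not divisible by `27` ⟹ modular").
* `freyModularity_of_exists_isNewformOf'` — `exists_isNewformOf → FreyModularity` (one hypothesis: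
  BCDT 2001 Thm. A).

So item stmt-ABC-11340 closes by `exact freyModularity_of_CDT_theorem_7_1_2' h` the day
`BCDT.CDT_theorem_7_1_2` is discharged (or by `freyModularity_of_exists_isNewformOf'` from Thm. A).

## References

* C. Breuil, B. Conrad, F. Diamond, R. Taylor, *On the modularity of elliptic curves over `ℚ`:
  wild 3-adic exercises*, J. Amer. Math. Soc. 14 (2001), 843–939: Thm. A; p. 845, (2) and (6).
* B. Conrad, F. Diamond, R. Taylor, *Modularity of certain potentially Barsotti–Tate Galois
  representations*, J. Amer. Math. Soc. 12 (1999), 521–567: Thm. 7.1.2 (p. 551).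
* J. H. Silverman, *The Arithmetic of Elliptic Curves*, 2nd ed., GTM 106 (2009): Thm. VI.5.1.
-/

-- `Summit.<Summit>.<Problem>` is the mandated summit-side namespace (CONVENTIONS §2); for the
-- single-conjunct summit `ABC` the two coincide, so the duplicate `ABC.ABC` is deliberate.
set_option linter.dupNamespace false

noncomputable section

open scoped MatrixGroups ModularForm

open CongruenceSubgroup
open Literature.NumberTheory.EllipticCurves
open Literature.NumberTheory.EllipticCurves.ModularForms
open Literature.NumberTheory.Automorphic

namespace Summit.ABC.ABC.Theorems

/-- **Per curve and level, a parametrisation datum is exactly a newform** (unconditionally): for an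
elliptic curve `W/ℚ` and a level `N ≥ 1`, `Nonempty (ModularParametrizationData W N)` iff some
`f ∈ S₂(Γ₀(N))` is the newform of `W` (`IsNewformOf W f`, `aₙ(f) = aₙ(W)` for all `n`).  `→`: the
datum's own `f`; `←`: a Néron-type period pair `L` of `W/ℂ` exists (`exists_isNeronLatticeOf_holds`,
Silverman AEC VI.5.1), an integer `c ≠ 0` with `c Λ_f ⊆ Λ_L` exists by the tree's theorem
`IsNewformOf.exists_maninConstant_ne_zero_holds` ("(2) ⇒ (6)", BCDT 2001 p. 845: Shimura's
construction and Faltings' isogeny theorem), and the datum is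
`nonempty_modularParametrizationData_of_isNewformOf` (uniformisation and modular degree being
theorems of the tree). [cite: BCDTJAMS2001, p. 845, (2) ⇔ (6)] -/
theorem nonempty_modularParametrizationData_iff_isModularAt (W : WeierstrassCurve ℚ) [W.IsElliptic]
    (N : ℕ) [NeZero N] :
    Nonempty (ModularParametrizationData W N) ↔ ∃ f : CuspForm (Gamma0 N) 2, IsNewformOf W f := by
  refine ⟨fun ⟨D⟩ ↦ ⟨D.f, D.isNewformOf⟩, fun ⟨f, hf⟩ ↦ ?_⟩
  haveI : (W.baseChange ℂ).IsElliptic := by rw [WeierstrassCurve.baseChange]; infer_instance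
  obtain ⟨L, hL⟩ := exists_isNeronLatticeOf_holds (W.baseChange ℂ)
  obtain ⟨c, hc0, hc⟩ := IsNewformOf.exists_maninConstant_ne_zero_holds hf hL
  exact nonempty_modularParametrizationData_of_isNewformOf hf hL hc0 hc

/-- **The exact residual of item stmt-ABC-11340, unconditionally: `FreyModularity` is Modularity
(2) for Frey curves.**  `FreyModularity` holds iff for all coprime `a, b` with `ab(a+b) ≠ 0` and
`N = N_{E_(a,b)}` some `f ∈ S₂(Γ₀(N))` is the newform of the Frey model `y² = x(x − a)(x + b)`
(`IsNewformOf (freyCurve a b) f`: `aₙ(f) = aₙ(E_(a,b))` for all `n`) — condition (2) of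
Breuil–Conrad–Diamond–Taylor 2001, p. 845, at Carayol's level, restricted to Frey curves.  The
commensurability half of the earlier residual `freyModularity_iff_isNewformOf_and_commensurable`
is discharged by `IsNewformOf.exists_maninConstant_ne_zero_holds`; per curve this is
`nonempty_modularParametrizationData_iff_isModularAt` (the Frey model is elliptic by
`isElliptic_freyCurve`). [cite: BCDTJAMS2001, Thm. A with (2) of p. 845] -/
theorem freyModularity_iff_forall_exists_isNewformOf_freyCurve :
    Summit.ABC.ABC.Theses.DefiniteXi.FreyModularity ↔
      ∀ a b : ℤ, IsCoprime a b → a * b * (a + b) ≠ 0 → ∀ (N : ℕ) [NeZero N],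
        (freyCurve a b).conductorNorm ℤ = N →
          ∃ f : CuspForm (Gamma0 N) 2, IsNewformOf (freyCurve a b) f := by
  unfold Summit.ABC.ABC.Theses.DefiniteXi.FreyModularity
  refine forall₂_congr fun a b ↦ forall_congr' fun _ ↦ forall_congr' fun h0 ↦
    forall₂_congr fun N _ ↦ forall_congr' fun _ ↦ ?_
  haveI := isElliptic_freyCurve h0
  exact nonempty_modularParametrizationData_iff_isModularAt (freyCurve a b) N

/-- **`FreyModularity` ↔ every Frey curve is modular in the sense of BCDT** (`BCDT.IsModular W`:
a newform `f ∈ S₂(Γ₀(N_W))` with `IsNewformOf W f`, the conclusion of `BCDT.CDT_theorem_7_1_2` and,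
for all curves, of Theorem A = `exists_isNewformOf`): for all coprime `a, b` with `ab(a+b) ≠ 0`,
`BCDT.IsModular (freyCurve a b)` (the instance `NeZero N_{E_(a,b)}` quantified, as in the fact).
From `freyModularity_iff_forall_exists_isNewformOf_freyCurve` by substituting `N = N_{E_(a,b)}`.
[cite: BCDTJAMS2001, Introduction, condition (2)] -/
theorem freyModularity_iff_forall_isModular_freyCurve :
    Summit.ABC.ABC.Theses.DefiniteXi.FreyModularity ↔
      ∀ a b : ℤ, IsCoprime a b → a * b * (a + b) ≠ 0 →
        ∀ [NeZero ((freyCurve a b).conductorNorm ℤ)], BCDT.IsModular (freyCurve a b) := by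
  rw [freyModularity_iff_forall_exists_isNewformOf_freyCurve]
  refine forall₂_congr fun a b ↦ forall_congr' fun _ ↦ forall_congr' fun _ ↦ ?_
  exact ⟨fun h _ ↦ h _ rfl, fun h N _ hN ↦ by subst hN; exact h⟩

/-- **`FreyModularity` from Conrad–Diamond–Taylor 1999, Thm. 7.1.2 alone.**  If every elliptic curve
over `ℚ` whose conductor is not divisible by `27` is modular (`BCDT.CDT_theorem_7_1_2`), then
`FreyModularity` holds: `27 ∤ N_{E_(a,b)}` (`not_nine_dvd_conductorNorm_freyCurve`, from
`N ∣ 2⁸·rad(ab(a+b))`), and the commensurability input of `freyModularity_of_CDT_theorem_7_1_2` is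
the theorem `IsNewformOf.exists_maninConstant_ne_zero_holds`.  This is the one-hypothesis form the
item closes with once CDT Thm. 7.1.2 is discharged. [cite: ConradDiamondTaylor1999, Thm. 7.1.2] -/
theorem freyModularity_of_CDT_theorem_7_1_2' (h712 : BCDT.CDT_theorem_7_1_2) :
    Summit.ABC.ABC.Theses.DefiniteXi.FreyModularity :=
  freyModularity_of_CDT_theorem_7_1_2 h712 IsNewformOf.exists_maninConstant_ne_zero_holds

/-- **`FreyModularity` from the Modularity Theorem alone** (Breuil–Conrad–Diamond–Taylor 2001,
Thm. A in the form (2) = `exists_isNewformOf`): the commensurability input of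
`freyModularity_of_exists_isNewformOf` is the theorem
`IsNewformOf.exists_maninConstant_ne_zero_holds`. [cite: BCDTJAMS2001, Thm. A] -/
theorem freyModularity_of_exists_isNewformOf' (h₁ : exists_isNewformOf) :
    Summit.ABC.ABC.Theses.DefiniteXi.FreyModularity :=
  freyModularity_of_exists_isNewformOf h₁ IsNewformOf.exists_maninConstant_ne_zero_holds

/-- **Conversely, `FreyModularity` is not weaker than modularity of Frey curves**: it yields
`BCDT.IsModular (freyCurve a b)` for all coprime `a, b` with `ab(a+b) ≠ 0` (the `→` half of
`freyModularity_iff_forall_isModular_freyCurve`, curried for use). [cite: BCDTJAMS2001, Thm. A] -/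
theorem isModular_freyCurve_of_freyModularity (h : Summit.ABC.ABC.Theses.DefiniteXi.FreyModularity)
    {a b : ℤ} (hab : IsCoprime a b) (h0 : a * b * (a + b) ≠ 0)
    [NeZero ((freyCurve a b).conductorNorm ℤ)] : BCDT.IsModular (freyCurve a b) :=
  freyModularity_iff_forall_isModular_freyCurve.mp h a b hab h0

end Summit.ABC.ABC.Theorems

end
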